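import Summits.QuantumFields.BalabanUV.T4Continuum.Support.CTScalarGreen

/-!
# T⁴ programme, SUBSTRATE (shared lattice-gauge analysis library) — THE CONJUGATION OF THE SANDWICHED GREEN FUNCTIONS `∂G′` AND `Q̃′G′` IS
# SMALL: `‖c(∂G′) − ∂G′‖ ≤ EdG(κ)`, `‖c(Q̃′G′) − Q̃′G′‖ ≤ EQG(κ)` with `EdG, EQG = O(κ)` by the RESOLVENT IDENTITY
# `cG′ − G′ = cG′·(Δ′ − cΔ′)·G′`, `Δ′ − cΔ′ = −(c∂ᴴ − ∂ᴴ)·c∂ − ∂ᴴ·(c∂ − ∂) + a′(Π′ − cΠ′)` (programme VEC, file 4, `U = 1`)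

Substrate cell `b2b-balaban-substrate-*`, seat p3.  The conjugated Green function `cG′ = (cΔ′)⁻¹` is NOT close to `G′` in operator norm (`‖cΔ′ − Δ′‖ ~ nκ`),
but every SANDWICH with a gradient or an averaging is: the unbounded factors `∂`, `∂ᴴ` only ever appear next to `G′` ∕ `cG′`, where file 3b
(`CTScalarGreen`) bounds them level-freely (`‖∂cG′‖`, `‖c(G′∂ᴴ)‖ ≤ K₂`, `‖∂c(G′∂ᴴ)‖ ≤ K₁`).  With `γw = γ′ − Jfree`, `c₁ = 2√d|κ|e^{|κ|}`, `ε_Q = e^{|κ|Λ} − 1`: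
 * §1 generic ([folklore]): `isUnit_det_conjMat`, the resolvent identity **`conjMat_inv_sub_eq`** (`cA⁻¹ − A⁻¹ = cA⁻¹·(A − cA)·A⁻¹`), and the sandwich
   expansion `conjMat_mul_inv_sub_eq` (`c(YA⁻¹) − YA⁻¹ = (cY − Y)·cA⁻¹ + Y·cA⁻¹·(A − cA)·A⁻¹`);
 * §2 at `Δ′`: **`DeltaPs_sub_conj_eq`** (the three-term formula above);
 * §3 the bounds: `opNorm_conjGrad_Gps_le` (`‖c∂·G′‖ ≤ √(1/γ′) + c₁/γ′`), `opNorm_GradOp_conjGps_GradOpH_le` (`‖∂·cG′·∂ᴴ‖ ≤ K₁ + B_∂·c₁`),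
   `opNorm_conjGps_GradOpH_le` (`‖cG′·∂ᴴ‖ ≤ K₂ + c₁/γw`), whence **`opNorm_conjMat_GradOp_Gps_sub_le`** (`≤ EdG d a′ κ Λ`) and
   **`opNorm_conjMat_Qiso_Gps_sub_le`** (`≤ EQG d a′ κ Λ`), and by Hermitian symmetry (`(∂G′)ᴴ = G′∂ᴴ`, evenness of the constants in `κ`)
   **`opNorm_conjMat_Gps_GradOpH_sub_le`**, **`opNorm_conjMat_Gps_QisoH_sub_le`**.  `EdG`, `EQG` vanish at `κ = 0` (every term carries `c₁` or `ε_Q`).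
These are the inputs of VEC-5 (`Kcomp = Q̃′G′G′Q̃′ᴴ`, the projection term `∂·Pone·∂ᴴ = (∂G′Q̃′ᴴ)·Kcomp⁻¹·(Q̃′G′∂ᴴ)`).

HONEST FRAMING (T4-DAG p. 1).  `U = 1` lattice linear algebra ([folklore]); no estimate of any NE row; nothing printed is a hypothesis or a conclusion;
no `def … : Prop` (two real constants `EdG`, `EQG`); spine 0/9 unchanged; NOT infinite volume ∕ mass gap ∕ Clay.  HONEST DEPENDENCY: continuum YM on
T⁴ ⇐ BetaPertH ∧ nine spine estimates (0/9 proved); BetaPertH ⇐ (D1) ∧ (D4) ∧ CAP+tail; G-an2-4 gates asym, D1 and NE2/3/4.  ABSOLUTE RULE kept; no `sorry`.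
-/

noncomputable section

open scoped BigOperators ComplexConjugate Matrix Matrix.Norms.L2Operator ComplexOrder

namespace Summit.QuantumFields.BalabanUV.T4Continuum.CTScalarGreenComm

open Literature.MathematicalPhysics.QuantumFieldTheory.Balaban1983to89.B5Prop11Plancherel (Tor fine unitVec)
open Literature.MathematicalPhysics.QuantumFieldTheory.Balaban1983to89.B5Action121 (GradOp)
open Literature.MathematicalPhysics.QuantumFieldTheory.Balaban1983to89.B5Blocks16 (blockOf)
open Summit.QuantumFields.BalabanUV.T4Continuum
open Summit.QuantumFields.BalabanUV.T4Continuum.ScalarBlockPoincare (PiS)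
open Summit.QuantumFields.BalabanUV.T4Continuum.ScalarAveragedPropagator (DeltaPs Gps gammaPs gammaPs_pos isUnit_det_DeltaPs Gps_isHermitian opNorm_Gps_le
  opNorm_GradOp_mul_Gps_le)
open Summit.QuantumFields.BalabanUV.T4Continuum.ScalarAveragedCompression (Qiso opNorm_Qiso_le)
open Summit.QuantumFields.BalabanUV.T4Continuum.ScalarLayerFreeInputs (DeltaPs_eq_gram)
open Summit.QuantumFields.BalabanUV.T4Continuum.CTWeightedCoercivity
open Summit.QuantumFields.BalabanUV.T4Continuum.CTConjugationPieces
open Summit.QuantumFields.BalabanUV.T4Continuum.CTConjugationTorus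
open Summit.QuantumFields.BalabanUV.T4Continuum.CTWeightedEnergy (K1 K2 K1_nonneg K2_nonneg)
open Summit.QuantumFields.BalabanUV.T4Continuum.CTScalarGreen

/-! ## §1 Generic: the resolvent identity for conjugated inverses -/

section Generic

variable {ι σ : Type*} [Fintype ι] [DecidableEq ι] [Fintype σ] [DecidableEq σ]

/-- the conjugated matrix of an invertible matrix is invertible (`cA = W·A·W⁻¹`). [folklore] -/
theorem isUnit_det_conjMat (κ : ℝ) (ρ : ι → ℝ) {A : Matrix ι ι ℂ} (hA : IsUnit A.det) : IsUnit (conjMat κ ρ ρ A).det := by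
  rw [conjMat_eq_diag_mul, Matrix.det_mul, Matrix.det_mul]
  exact ((Matrix.isUnit_det_of_right_inverse (wdiag_mul_wdiag_neg κ ρ)).mul hA).mul (Matrix.isUnit_det_of_left_inverse (wdiag_mul_wdiag_neg κ ρ))

/-- **THE RESOLVENT IDENTITY** `cA⁻¹ − A⁻¹ = cA⁻¹·(A − cA)·A⁻¹`. [folklore] -/
theorem conjMat_inv_sub_eq (κ : ℝ) (ρ : ι → ℝ) {A : Matrix ι ι ℂ} (hA : IsUnit A.det) :
    conjMat κ ρ ρ A⁻¹ - A⁻¹ = conjMat κ ρ ρ A⁻¹ * (A - conjMat κ ρ ρ A) * A⁻¹ := by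
  rw [conjMat_inv, GaugeTermResolventBounds.inv_sub_inv_eq' (isUnit_det_conjMat κ ρ hA) hA]

omit [Fintype σ] [DecidableEq σ] in
/-- the SANDWICH expansion `c(YA⁻¹) − YA⁻¹ = (cY − Y)·cA⁻¹ + Y·(cA⁻¹·(A − cA)·A⁻¹)`. [folklore] -/
theorem conjMat_mul_inv_sub_eq (κ : ℝ) (σw : σ → ℝ) (ρ : ι → ℝ) (Y : Matrix σ ι ℂ) {A : Matrix ι ι ℂ} (hA : IsUnit A.det) :
    conjMat κ σw ρ (Y * A⁻¹) - Y * A⁻¹ = (conjMat κ σw ρ Y - Y) * conjMat κ ρ ρ A⁻¹ + Y * (conjMat κ ρ ρ A⁻¹ * (A - conjMat κ ρ ρ A) * A⁻¹) := by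
  rw [← conjMat_inv_sub_eq κ ρ hA, conjMat_mul κ σw ρ ρ, Matrix.sub_mul, Matrix.mul_sub]
  abel

end Generic

/-! ## §2 At `Δ′ = ∂ᴴ∂ + a′Π′` -/

section DeltaPs

variable {d : ℕ} (n : ℕ) [NeZero n] (M : Fin d → ℕ) [hM : ∀ μ, NeZero (M μ)]
variable {ρ₀ : Tor (fine n M) → ℝ} {κ a' Λ : ℝ}

/-- **`Δ′ − cΔ′ = −(c∂ᴴ − ∂ᴴ)·c∂ − ∂ᴴ·(c∂ − ∂) + a′·(Π′ − cΠ′)`**. [folklore] -/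
theorem DeltaPs_sub_conj_eq (κ : ℝ) (ρ₀ : Tor (fine n M) → ℝ) (a' : ℝ) :
    DeltaPs n M a' - conjMat κ ρ₀ ρ₀ (DeltaPs n M a')
      = -((conjMat κ ρ₀ (bondW₀ n M ρ₀) (GradOp (fine n M) ((n : ℕ) : ℂ))ᴴ - (GradOp (fine n M) ((n : ℕ) : ℂ))ᴴ)
            * conjMat κ (bondW₀ n M ρ₀) ρ₀ (GradOp (fine n M) ((n : ℕ) : ℂ)))
        - (GradOp (fine n M) ((n : ℕ) : ℂ))ᴴ * (conjMat κ (bondW₀ n M ρ₀) ρ₀ (GradOp (fine n M) ((n : ℕ) : ℂ)) - GradOp (fine n M) ((n : ℕ) : ℂ))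
        + (a' : ℂ) • (PiS n M - conjMat κ ρ₀ ρ₀ (PiS n M)) := by
  rw [DeltaPs_eq_gram, conjMat_add, conjMat_smul, conjMat_mul κ ρ₀ (bondW₀ n M ρ₀) ρ₀]
  simp only [Matrix.sub_mul, Matrix.mul_sub, smul_sub]
  abel

end DeltaPs

/-! ## §3 The bounds -/

section Bounds

variable {d : ℕ} (n : ℕ) [NeZero n] (M : Fin d → ℕ) [hM : ∀ μ, NeZero (M μ)]
variable {ρ₀ : Tor (fine n M) → ℝ} {κ a' Λ : ℝ}

/-- `γw = γ′ − Jfree`. [folklore] -/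
abbrev gw (d : ℕ) (a' κ Λ : ℝ) : ℝ := gammaPs d a' - Jfree d a' κ Λ

/-- `B_∂ = √(1/γw + Jfree/γw²)` (the bound of `‖∂·cG′‖`). [folklore] -/
abbrev BdG (d : ℕ) (a' κ Λ : ℝ) : ℝ := Real.sqrt (1 / gw d a' κ Λ + Jfree d a' κ Λ / gw d a' κ Λ ^ 2)

/-- `ε_Q = e^{|κ|Λ} − 1`. [folklore] -/
abbrev epsQ (κ Λ : ℝ) : ℝ := Real.exp (|κ| * Λ) - 1

/-- **the smallness constant of `∂G′`**: `EdG = c₁/γw + B_∂·c₁·(√(1/γ′) + c₁/γ′) + (K₁ + B_∂c₁)·c₁/γ′ + a′B_∂·ε_Q/γ′`. [folklore] -/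
def EdG (d : ℕ) (a' κ Λ : ℝ) : ℝ :=
  c1 d κ * (gw d a' κ Λ)⁻¹
    + BdG d a' κ Λ * c1 d κ * (Real.sqrt ((gammaPs d a')⁻¹) + c1 d κ * (gammaPs d a')⁻¹)
    + (K1 (gw d a' κ Λ) (Jfree d a' κ Λ) (c1 d κ) + BdG d a' κ Λ * c1 d κ) * (c1 d κ * (gammaPs d a')⁻¹)
    + a' * BdG d a' κ Λ * (epsQ κ Λ * (gammaPs d a')⁻¹)

/-- **the smallness constant of `Q̃′G′`**: `EQG = ε_Q/γw + (c₁/γw)·(√(1/γ′) + c₁/γ′) + (K₂ + c₁/γw)·c₁/γ′ + a′·ε_Q/(γw γ′)`. [folklore] -/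
def EQG (d : ℕ) (a' κ Λ : ℝ) : ℝ :=
  epsQ κ Λ * (gw d a' κ Λ)⁻¹
    + (gw d a' κ Λ)⁻¹ * c1 d κ * (Real.sqrt ((gammaPs d a')⁻¹) + c1 d κ * (gammaPs d a')⁻¹)
    + (K2 (gw d a' κ Λ) (Jfree d a' κ Λ) (c1 d κ) + c1 d κ * (gw d a' κ Λ)⁻¹) * (c1 d κ * (gammaPs d a')⁻¹)
    + a' * (gw d a' κ Λ)⁻¹ * (epsQ κ Λ * (gammaPs d a')⁻¹)

/-- `‖c∂·G′‖ ≤ √(1/γ′) + c₁/γ′` (`c∂·G′ = ∂G′ + (c∂ − ∂)G′`). [folklore] -/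
theorem opNorm_conjGrad_Gps_le (ha' : 0 < a') (hlip : ∀ x ν, |ρ₀ (x + unitVec (fine n M) ν) - ρ₀ x| ≤ 1 / n) :
    ‖conjMat κ (bondW₀ n M ρ₀) ρ₀ (GradOp (fine n M) ((n : ℕ) : ℂ)) * Gps n M a'‖ ≤ Real.sqrt ((gammaPs d a')⁻¹) + c1 d κ * (gammaPs d a')⁻¹ := by
  rw [show conjMat κ (bondW₀ n M ρ₀) ρ₀ (GradOp (fine n M) ((n : ℕ) : ℂ)) * Gps n M a'
      = GradOp (fine n M) ((n : ℕ) : ℂ) * Gps n M a' + (conjMat κ (bondW₀ n M ρ₀) ρ₀ (GradOp (fine n M) ((n : ℕ) : ℂ)) - GradOp (fine n M) ((n : ℕ) : ℂ)) * Gps n M a' by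
      rw [Matrix.sub_mul, add_sub_cancel]]
  exact (norm_add_le _ _).trans (add_le_add (opNorm_GradOp_mul_Gps_le n M ha')
    ((Matrix.l2_opNorm_mul _ _).trans (mul_le_mul (opNorm_conjMat_GradOp_sub_le n M κ hlip) (opNorm_Gps_le n M ha') (norm_nonneg _) (c1_nonneg d κ))))

/-- `‖∂·cG′·∂ᴴ‖ ≤ K₁ + B_∂·c₁` (`∂cG′∂ᴴ = ∂·c(G′∂ᴴ) − ∂cG′·(c∂ᴴ − ∂ᴴ)`). [folklore] -/
theorem opNorm_GradOp_conjGps_GradOpH_le (ha' : 0 < a') (hlip : ∀ x ν, |ρ₀ (x + unitVec (fine n M) ν) - ρ₀ x| ≤ 1 / n)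
    (hosc : ∀ x x', blockOf n M x = blockOf n M x' → |ρ₀ x - ρ₀ x'| ≤ Λ) (hγ : Jfree d a' κ Λ < gammaPs d a') :
    ‖GradOp (fine n M) ((n : ℕ) : ℂ) * conjMat κ ρ₀ ρ₀ (Gps n M a') * (GradOp (fine n M) ((n : ℕ) : ℂ))ᴴ‖
      ≤ K1 (gw d a' κ Λ) (Jfree d a' κ Λ) (c1 d κ) + BdG d a' κ Λ * c1 d κ := by
  set D := GradOp (fine n M) ((n : ℕ) : ℂ) with hD
  set cG := conjMat κ ρ₀ ρ₀ (Gps n M a') with hcG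
  set cDH := conjMat κ ρ₀ (bondW₀ n M ρ₀) Dᴴ with hcDH
  have e : D * cG * Dᴴ = D * conjMat κ ρ₀ (bondW₀ n M ρ₀) (Gps n M a' * Dᴴ) - D * cG * (cDH - Dᴴ) := by
    rw [conjMat_mul κ ρ₀ ρ₀ (bondW₀ n M ρ₀), ← hcG, ← hcDH, Matrix.mul_sub, Matrix.mul_assoc, Matrix.mul_assoc, sub_sub_cancel]
  rw [e]
  calc _ ≤ ‖D * conjMat κ ρ₀ (bondW₀ n M ρ₀) (Gps n M a' * Dᴴ)‖ + ‖D * cG * (cDH - Dᴴ)‖ := norm_sub_le _ _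
    _ ≤ K1 (gw d a' κ Λ) (Jfree d a' κ Λ) (c1 d κ) + BdG d a' κ Λ * c1 d κ := by
        refine add_le_add ?_ ((Matrix.l2_opNorm_mul _ _).trans (mul_le_mul ?_ (opNorm_conjMat_GradOpH_sub_le n M κ hlip) (norm_nonneg _)
          (Real.sqrt_nonneg _)))
        · rw [hD, Gps]; exact opNorm_GradOp_conjMat_Gps_GradOpH_le n M ha' hlip hosc hγ
        · rw [hD, hcG]; exact opNorm_GradOp_conjMat_Gps_le n M ha' hlip hosc hγ

/-- `‖cG′·∂ᴴ‖ ≤ K₂ + c₁/γw` (`cG′∂ᴴ = c(G′∂ᴴ) − cG′·(c∂ᴴ − ∂ᴴ)`). [folklore] -/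
theorem opNorm_conjGps_GradOpH_le (ha' : 0 < a') (hlip : ∀ x ν, |ρ₀ (x + unitVec (fine n M) ν) - ρ₀ x| ≤ 1 / n)
    (hosc : ∀ x x', blockOf n M x = blockOf n M x' → |ρ₀ x - ρ₀ x'| ≤ Λ) (hγ : Jfree d a' κ Λ < gammaPs d a') :
    ‖conjMat κ ρ₀ ρ₀ (Gps n M a') * (GradOp (fine n M) ((n : ℕ) : ℂ))ᴴ‖ ≤ K2 (gw d a' κ Λ) (Jfree d a' κ Λ) (c1 d κ) + c1 d κ * (gw d a' κ Λ)⁻¹ := by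
  set D := GradOp (fine n M) ((n : ℕ) : ℂ) with hD
  set cG := conjMat κ ρ₀ ρ₀ (Gps n M a') with hcG
  set cDH := conjMat κ ρ₀ (bondW₀ n M ρ₀) Dᴴ with hcDH
  have e : cG * Dᴴ = conjMat κ ρ₀ (bondW₀ n M ρ₀) (Gps n M a' * Dᴴ) - cG * (cDH - Dᴴ) := by
    rw [conjMat_mul κ ρ₀ ρ₀ (bondW₀ n M ρ₀), ← hcG, ← hcDH, Matrix.mul_sub, sub_sub_cancel]
  rw [e]
  calc _ ≤ ‖conjMat κ ρ₀ (bondW₀ n M ρ₀) (Gps n M a' * Dᴴ)‖ + ‖cG * (cDH - Dᴴ)‖ := norm_sub_le _ _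
    _ ≤ K2 (gw d a' κ Λ) (Jfree d a' κ Λ) (c1 d κ) + (gw d a' κ Λ)⁻¹ * c1 d κ := by
        refine add_le_add ?_ ((Matrix.l2_opNorm_mul _ _).trans (mul_le_mul ?_ (opNorm_conjMat_GradOpH_sub_le n M κ hlip) (norm_nonneg _)
          (inv_nonneg.mpr (by linarith))))
        · rw [hD, Gps]; exact opNorm_conjMat_Gps_GradOpH_le n M ha' hlip hosc hγ
        · rw [hcG]; exact opNorm_conjMat_Gps_le n M ha' hlip hosc hγ
    _ = _ := by ring

/-- **`‖c(∂G′) − ∂G′‖ ≤ EdG`** — the conjugation of the gradient sandwich is small (`O(κ)`), level-free. [folklore] -/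
theorem opNorm_conjMat_GradOp_Gps_sub_le (ha' : 0 < a') (hΛ : 0 ≤ Λ) (hlip : ∀ x ν, |ρ₀ (x + unitVec (fine n M) ν) - ρ₀ x| ≤ 1 / n)
    (hosc : ∀ x x', blockOf n M x = blockOf n M x' → |ρ₀ x - ρ₀ x'| ≤ Λ) (hγ : Jfree d a' κ Λ < gammaPs d a') :
    ‖conjMat κ (bondW₀ n M ρ₀) ρ₀ (GradOp (fine n M) ((n : ℕ) : ℂ) * Gps n M a') - GradOp (fine n M) ((n : ℕ) : ℂ) * Gps n M a'‖ ≤ EdG d a' κ Λ := by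
  have hγ' := (gammaPs_pos (d := d) (a' := a')).1
  set D := GradOp (fine n M) ((n : ℕ) : ℂ) with hD
  set G := Gps n M a' with hG
  set cG := conjMat κ ρ₀ ρ₀ G with hcG
  set cD := conjMat κ (bondW₀ n M ρ₀) ρ₀ D with hcD
  set E₁ := conjMat κ ρ₀ (bondW₀ n M ρ₀) Dᴴ - Dᴴ with hE₁
  set E₂ := cD - D with hE₂
  set E₃ := PiS n M - conjMat κ ρ₀ ρ₀ (PiS n M) with hE₃
  have hU : IsUnit (DeltaPs n M a').det := isUnit_det_DeltaPs n M ha'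
  -- the expansion
  have hexp : conjMat κ (bondW₀ n M ρ₀) ρ₀ (D * G) - D * G
      = E₂ * cG - (D * cG * E₁) * (cD * G) - (D * cG * Dᴴ) * (E₂ * G) + (a' : ℂ) • ((D * cG) * (E₃ * G)) := by
    rw [hG, Gps, conjMat_mul_inv_sub_eq κ (bondW₀ n M ρ₀) ρ₀ D hU, ← Gps, ← hG, ← hcG, ← hcD, ← hE₂, DeltaPs_sub_conj_eq n M κ ρ₀ a',
      ← hD, ← hcD, ← hE₁, ← hE₂, ← hE₃]
    simp only [Matrix.mul_add, Matrix.mul_sub, Matrix.mul_neg, Matrix.add_mul, Matrix.sub_mul, Matrix.neg_mul, Matrix.mul_smul, Matrix.smul_mul,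
      Matrix.mul_assoc]
    abel
  -- the pieces
  have h1 : ‖E₂‖ ≤ c1 d κ := by rw [hE₂, hcD, hD]; exact opNorm_conjMat_GradOp_sub_le n M κ hlip
  have h1' : ‖E₁‖ ≤ c1 d κ := by rw [hE₁, hD]; exact opNorm_conjMat_GradOpH_sub_le n M κ hlip
  have h2 : ‖cG‖ ≤ (gw d a' κ Λ)⁻¹ := by rw [hcG, hG]; exact opNorm_conjMat_Gps_le n M ha' hlip hosc hγ
  have h3 : ‖D * cG‖ ≤ BdG d a' κ Λ := by rw [hcG, hG, hD]; exact opNorm_GradOp_conjMat_Gps_le n M ha' hlip hosc hγ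
  have h4 : ‖cD * G‖ ≤ Real.sqrt ((gammaPs d a')⁻¹) + c1 d κ * (gammaPs d a')⁻¹ := by rw [hcD, hG, hD]; exact opNorm_conjGrad_Gps_le n M ha' hlip
  have h5 : ‖D * cG * Dᴴ‖ ≤ K1 (gw d a' κ Λ) (Jfree d a' κ Λ) (c1 d κ) + BdG d a' κ Λ * c1 d κ := by
    rw [hcG, hG, hD]; exact opNorm_GradOp_conjGps_GradOpH_le n M ha' hlip hosc hγ
  have h6 : ‖G‖ ≤ (gammaPs d a')⁻¹ := by rw [hG]; exact opNorm_Gps_le n M ha'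
  have h7 : ‖E₃‖ ≤ epsQ κ Λ := by rw [hE₃, ← norm_neg, neg_sub]; exact opNorm_conjMat_PiS_sub_le n M κ hΛ hosc
  have hc1 := c1_nonneg d κ
  have hB0 : 0 ≤ BdG d a' κ Λ := Real.sqrt_nonneg _
  have hε0 : 0 ≤ epsQ κ Λ := sub_nonneg.mpr (Real.one_le_exp (by positivity))
  have hK1 := K1_nonneg (gw d a' κ Λ) (Jfree d a' κ Λ) (c1 d κ)
  rw [hexp, EdG]
  calc _ ≤ ‖E₂ * cG‖ + ‖D * cG * E₁ * (cD * G)‖ + ‖D * cG * Dᴴ * (E₂ * G)‖ + ‖(a' : ℂ) • (D * cG * (E₃ * G))‖ := by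
          refine (norm_add_le _ _).trans (add_le_add ((norm_sub_le _ _).trans (add_le_add (norm_sub_le _ _) le_rfl)) le_rfl)
    _ ≤ c1 d κ * (gw d a' κ Λ)⁻¹ + BdG d a' κ Λ * c1 d κ * (Real.sqrt ((gammaPs d a')⁻¹) + c1 d κ * (gammaPs d a')⁻¹)
          + (K1 (gw d a' κ Λ) (Jfree d a' κ Λ) (c1 d κ) + BdG d a' κ Λ * c1 d κ) * (c1 d κ * (gammaPs d a')⁻¹)
          + a' * BdG d a' κ Λ * (epsQ κ Λ * (gammaPs d a')⁻¹) := by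
        gcongr
        · exact (Matrix.l2_opNorm_mul _ _).trans (mul_le_mul h1 h2 (norm_nonneg _) hc1)
        · exact (Matrix.l2_opNorm_mul _ _).trans (mul_le_mul ((Matrix.l2_opNorm_mul _ _).trans (mul_le_mul h3 h1' (norm_nonneg _) hB0)) h4
            (norm_nonneg _) (mul_nonneg hB0 hc1))
        · exact (Matrix.l2_opNorm_mul _ _).trans (mul_le_mul h5 ((Matrix.l2_opNorm_mul _ _).trans (mul_le_mul h1 h6 (norm_nonneg _) hc1))
            (norm_nonneg _) (by positivity))
        · rw [norm_smul, Complex.norm_real, Real.norm_of_nonneg ha'.le, mul_assoc]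
          exact mul_le_mul_of_nonneg_left ((Matrix.l2_opNorm_mul _ _).trans (mul_le_mul h3 ((Matrix.l2_opNorm_mul _ _).trans
            (mul_le_mul h7 h6 (norm_nonneg _) hε0)) (norm_nonneg _) hB0)) ha'.le

/-- **`‖c(Q̃′G′) − Q̃′G′‖ ≤ EQG`** — the conjugation of the averaging sandwich is small (`O(κ)`), level-free. [folklore] -/
theorem opNorm_conjMat_Qiso_Gps_sub_le (ha' : 0 < a') (hΛ : 0 ≤ Λ) (hlip : ∀ x ν, |ρ₀ (x + unitVec (fine n M) ν) - ρ₀ x| ≤ 1 / n)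
    (hosc : ∀ x x', blockOf n M x = blockOf n M x' → |ρ₀ x - ρ₀ x'| ≤ Λ) (hγ : Jfree d a' κ Λ < gammaPs d a') :
    ‖conjMat κ (coarseW n M ρ₀) ρ₀ (Qiso n M * Gps n M a') - Qiso n M * Gps n M a'‖ ≤ EQG d a' κ Λ := by
  have hγ' := (gammaPs_pos (d := d) (a' := a')).1
  have hgw : 0 < gw d a' κ Λ := by rw [gw]; linarith
  set D := GradOp (fine n M) ((n : ℕ) : ℂ) with hD
  set G := Gps n M a' with hG
  set Q := Qiso n M with hQ
  set cG := conjMat κ ρ₀ ρ₀ G with hcG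
  set cD := conjMat κ (bondW₀ n M ρ₀) ρ₀ D with hcD
  set E₁ := conjMat κ ρ₀ (bondW₀ n M ρ₀) Dᴴ - Dᴴ with hE₁
  set E₂ := cD - D with hE₂
  set E₃ := PiS n M - conjMat κ ρ₀ ρ₀ (PiS n M) with hE₃
  set EQ := conjMat κ (coarseW n M ρ₀) ρ₀ Q - Q with hEQ
  have hU : IsUnit (DeltaPs n M a').det := isUnit_det_DeltaPs n M ha'
  have hexp : conjMat κ (coarseW n M ρ₀) ρ₀ (Q * G) - Q * G
      = EQ * cG - (Q * cG * E₁) * (cD * G) - (Q * cG * Dᴴ) * (E₂ * G) + (a' : ℂ) • ((Q * cG) * (E₃ * G)) := by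
    rw [hG, Gps, conjMat_mul_inv_sub_eq κ (coarseW n M ρ₀) ρ₀ Q hU, ← Gps, ← hG, ← hcG, ← hEQ, DeltaPs_sub_conj_eq n M κ ρ₀ a',
      ← hD, ← hcD, ← hE₁, ← hE₂, ← hE₃]
    simp only [Matrix.mul_add, Matrix.mul_sub, Matrix.mul_neg, Matrix.add_mul, Matrix.sub_mul, Matrix.neg_mul, Matrix.mul_smul, Matrix.smul_mul,
      Matrix.mul_assoc]
    abel
  have h0 : ‖EQ‖ ≤ epsQ κ Λ := by rw [hEQ, hQ]; exact opNorm_conjMat_Qiso_sub_le n M κ hΛ hosc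
  have h1 : ‖E₂‖ ≤ c1 d κ := by rw [hE₂, hcD, hD]; exact opNorm_conjMat_GradOp_sub_le n M κ hlip
  have h1' : ‖E₁‖ ≤ c1 d κ := by rw [hE₁, hD]; exact opNorm_conjMat_GradOpH_sub_le n M κ hlip
  have h2 : ‖cG‖ ≤ (gw d a' κ Λ)⁻¹ := by rw [hcG, hG]; exact opNorm_conjMat_Gps_le n M ha' hlip hosc hγ
  have hQn : ‖Q‖ ≤ 1 := by rw [hQ]; exact opNorm_Qiso_le n M
  have h3 : ‖Q * cG‖ ≤ (gw d a' κ Λ)⁻¹ :=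
    (Matrix.l2_opNorm_mul _ _).trans ((mul_le_mul hQn h2 (norm_nonneg _) zero_le_one).trans (by rw [one_mul]))
  have h4 : ‖cD * G‖ ≤ Real.sqrt ((gammaPs d a')⁻¹) + c1 d κ * (gammaPs d a')⁻¹ := by rw [hcD, hG, hD]; exact opNorm_conjGrad_Gps_le n M ha' hlip
  have h5 : ‖Q * cG * Dᴴ‖ ≤ K2 (gw d a' κ Λ) (Jfree d a' κ Λ) (c1 d κ) + c1 d κ * (gw d a' κ Λ)⁻¹ := by
    rw [Matrix.mul_assoc]
    refine (Matrix.l2_opNorm_mul _ _).trans ((mul_le_mul hQn ?_ (norm_nonneg _) zero_le_one).trans (by rw [one_mul]))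
    rw [hcG, hG, hD]; exact opNorm_conjGps_GradOpH_le n M ha' hlip hosc hγ
  have h6 : ‖G‖ ≤ (gammaPs d a')⁻¹ := by rw [hG]; exact opNorm_Gps_le n M ha'
  have h7 : ‖E₃‖ ≤ epsQ κ Λ := by rw [hE₃, ← norm_neg, neg_sub]; exact opNorm_conjMat_PiS_sub_le n M κ hΛ hosc
  have hc1 := c1_nonneg d κ
  have hε0 : 0 ≤ epsQ κ Λ := sub_nonneg.mpr (Real.one_le_exp (by positivity))
  have hK2 := K2_nonneg (gw d a' κ Λ) (Jfree d a' κ Λ) (c1 d κ)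
  have hgw0 : 0 ≤ (gw d a' κ Λ)⁻¹ := inv_nonneg.mpr hgw.le
  rw [hexp, EQG]
  calc _ ≤ ‖EQ * cG‖ + ‖Q * cG * E₁ * (cD * G)‖ + ‖Q * cG * Dᴴ * (E₂ * G)‖ + ‖(a' : ℂ) • (Q * cG * (E₃ * G))‖ := by
          refine (norm_add_le _ _).trans (add_le_add ((norm_sub_le _ _).trans (add_le_add (norm_sub_le _ _) le_rfl)) le_rfl)
    _ ≤ epsQ κ Λ * (gw d a' κ Λ)⁻¹ + (gw d a' κ Λ)⁻¹ * c1 d κ * (Real.sqrt ((gammaPs d a')⁻¹) + c1 d κ * (gammaPs d a')⁻¹)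
          + (K2 (gw d a' κ Λ) (Jfree d a' κ Λ) (c1 d κ) + c1 d κ * (gw d a' κ Λ)⁻¹) * (c1 d κ * (gammaPs d a')⁻¹)
          + a' * (gw d a' κ Λ)⁻¹ * (epsQ κ Λ * (gammaPs d a')⁻¹) := by
        gcongr
        · exact (Matrix.l2_opNorm_mul _ _).trans (mul_le_mul h0 h2 (norm_nonneg _) hε0)
        · exact (Matrix.l2_opNorm_mul _ _).trans (mul_le_mul ((Matrix.l2_opNorm_mul _ _).trans (mul_le_mul h3 h1' (norm_nonneg _) hgw0)) h4
            (norm_nonneg _) (mul_nonneg hgw0 hc1))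
        · exact (Matrix.l2_opNorm_mul _ _).trans (mul_le_mul h5 ((Matrix.l2_opNorm_mul _ _).trans (mul_le_mul h1 h6 (norm_nonneg _) hc1))
            (norm_nonneg _) (by positivity))
        · rw [norm_smul, Complex.norm_real, Real.norm_of_nonneg ha'.le, mul_assoc]
          exact mul_le_mul_of_nonneg_left ((Matrix.l2_opNorm_mul _ _).trans (mul_le_mul h3 ((Matrix.l2_opNorm_mul _ _).trans
            (mul_le_mul h7 h6 (norm_nonneg _) hε0)) (norm_nonneg _) hgw0)) ha'.le

/-! ### The adjoint sandwiches `G′∂ᴴ = (∂G′)ᴴ`, `G′Q̃′ᴴ = (Q̃′G′)ᴴ` (the constants are even in `κ`) -/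

omit [NeZero n] hM in
/-- `c₁(−κ) = c₁(κ)`. [folklore] -/
theorem c1_neg (d : ℕ) (κ : ℝ) : c1 d (-κ) = c1 d κ := by simp [c1, abs_neg]

omit [NeZero n] hM in
/-- `Jfree(−κ) = Jfree(κ)`. [folklore] -/
theorem Jfree_neg (d : ℕ) (a' κ Λ : ℝ) : Jfree d a' (-κ) Λ = Jfree d a' κ Λ := by simp [Jfree, neg_mul, Real.cosh_neg]

omit [NeZero n] hM in
/-- `EdG(−κ) = EdG(κ)`. [folklore] -/
theorem EdG_neg (d : ℕ) (a' κ Λ : ℝ) : EdG d a' (-κ) Λ = EdG d a' κ Λ := by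
  simp only [EdG, gw, BdG, epsQ, Jfree_neg, c1_neg, abs_neg]

omit [NeZero n] hM in
/-- `EQG(−κ) = EQG(κ)`. [folklore] -/
theorem EQG_neg (d : ℕ) (a' κ Λ : ℝ) : EQG d a' (-κ) Λ = EQG d a' κ Λ := by
  simp only [EQG, gw, epsQ, Jfree_neg, c1_neg, abs_neg]

/-- **`‖c(G′∂ᴴ) − G′∂ᴴ‖ ≤ EdG`** (adjoint rule + Hermitian `G′`). [folklore] -/
theorem opNorm_conjMat_Gps_GradOpH_sub_le (ha' : 0 < a') (hΛ : 0 ≤ Λ) (hlip : ∀ x ν, |ρ₀ (x + unitVec (fine n M) ν) - ρ₀ x| ≤ 1 / n)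
    (hosc : ∀ x x', blockOf n M x = blockOf n M x' → |ρ₀ x - ρ₀ x'| ≤ Λ) (hγ : Jfree d a' κ Λ < gammaPs d a') :
    ‖conjMat κ ρ₀ (bondW₀ n M ρ₀) (Gps n M a' * (GradOp (fine n M) ((n : ℕ) : ℂ))ᴴ) - Gps n M a' * (GradOp (fine n M) ((n : ℕ) : ℂ))ᴴ‖ ≤ EdG d a' κ Λ := by
  have hH : Gps n M a' * (GradOp (fine n M) ((n : ℕ) : ℂ))ᴴ = (GradOp (fine n M) ((n : ℕ) : ℂ) * Gps n M a')ᴴ := by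
    rw [Matrix.conjTranspose_mul, (Gps_isHermitian n M a').eq]
  rw [hH, opNorm_conjMat_conjTranspose_sub_eq, ← EdG_neg]
  exact opNorm_conjMat_GradOp_Gps_sub_le n M ha' hΛ hlip hosc (by rwa [Jfree_neg])

/-- **`‖c(G′Q̃′ᴴ) − G′Q̃′ᴴ‖ ≤ EQG`** (adjoint rule + Hermitian `G′`). [folklore] -/
theorem opNorm_conjMat_Gps_QisoH_sub_le (ha' : 0 < a') (hΛ : 0 ≤ Λ) (hlip : ∀ x ν, |ρ₀ (x + unitVec (fine n M) ν) - ρ₀ x| ≤ 1 / n)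
    (hosc : ∀ x x', blockOf n M x = blockOf n M x' → |ρ₀ x - ρ₀ x'| ≤ Λ) (hγ : Jfree d a' κ Λ < gammaPs d a') :
    ‖conjMat κ ρ₀ (coarseW n M ρ₀) (Gps n M a' * (Qiso n M)ᴴ) - Gps n M a' * (Qiso n M)ᴴ‖ ≤ EQG d a' κ Λ := by
  have hH : Gps n M a' * (Qiso n M)ᴴ = (Qiso n M * Gps n M a')ᴴ := by
    rw [Matrix.conjTranspose_mul, (Gps_isHermitian n M a').eq]
  rw [hH, opNorm_conjMat_conjTranspose_sub_eq, ← EQG_neg]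
  exact opNorm_conjMat_Qiso_Gps_sub_le n M ha' hΛ hlip hosc (by rwa [Jfree_neg])

end Bounds

end Summit.QuantumFields.BalabanUV.T4Continuum.CTScalarGreenComm

end
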